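/-
Copyright (c) 2026 the pub-hodgecm-mathlib formalisation cell (harness21).  Prover seat hodgecm-mathlib-K2E5-p16 (g9): Track B «K2-LIT», hLiu418 = stmt-HodgeConjecture-24832,
road `K2_Liu`, K1-a♮ (Iw-S₀) road (R2′) «monomial-flat at ★ p863501's interface», FILE A′ (K1a desk K2Liu-p01 (g11) WORD #3 (3) ∕ WORD #9 (2), 2026-09-05):
OFF `S₀` THE UNRAMIFIED SECTION `Λ_{s,v}` IS A HEIGHT TWIST OF `Λ_{s₀,v}`.
-/
import Summits.HodgeConjecture.HodgeConjecture.Theorems.K2LiuSiegelModulusCompact   -- ★ K2Liu-p23: `modDelta_locToAdelic_eq_one_of_mem_compact ∕ _of_mem_localInt`; brings ★ FILE A `K2LiuIwasawaHeightLocalModulus` (§1 `modDelta_locToAdelic_sq_eq_absDetDelta`, `exists_modDelta_locToAdelic_sq_eq_zpow`), ★ (E6) FILE 2 `heightLoc_siegel_mul`, `modDelta_cpow_mul_siegelDeltaCharacter`, Lit. `LocalDoublingSiegel` (`LambdaLoc`)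
import HarnessLib

/-!
# Crux `HLiu418`, road `K2_Liu`, K1-a♮ (Iw-S₀) road (R2′), FILE A′: off `S₀`, `Λ_{s,v}(u) = Hf(u)^{2(s−s₀)} · Λ_{s₀,v}(u)` with a height `Hf` of square in `q_v^ℤ`

Cell `hodgecm-mathlib`, crux item hLiu418 = `stmt-HodgeConjecture-24832`; squad K2; prover K2E5-p16 (g9).  THEOREMS ONLY (no `def`, no instance, no notation,
no named-fact hypothesis, no `sorry`); lane `--supports stmt-HodgeConjecture-24832 --as helper`.  Sequel of ★ FILE A `K2LiuIwasawaHeightLocalModulus` (p864504): there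
the `S₀`-factors `H_{𝒦,v}^{2(s−s₀)}·b` of a standard family were shown MONOMIAL-FLAT (`H_{𝒦,v}(u)² ∈ q_v^ℤ`); here the factors OFF `S₀` — the unramified sections
`Λ_{s,v}` of ★ K2Lit `LocalDoublingSiegel` (`Λ_{s,v}(p k) = χ_v(det_Δ p)|det_Δ p|_v^{s+n∕2}`, `p ∈ P_Δ(L⁺_v)`, `k ∈ K_{H,v}`, junk `0` off `P_Δ·K_H`) — get the SAME shape,
so the (R2′) consumer (FILE B `K2LiuKindOneSingularLocalFaceMonomial`, FILE C `…LocalFaceOfRecordEdTwo`) treats every place alike.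

* §0 `heightLoc_siegel_mul_sq` — the left law of `H_{𝒦,v}` squared, in ★ D1's `absDetDelta` currency ((f2′) for the `S₀`-factors);
* §1 `modDelta_locToAdelic_eq_of_decomp` — the modulus of the `P`-part of a `P_Δ·K_H` decomposition is well defined (`p k = p′ k′ ⇒ modDelta (ι_v p) = modDelta (ι_v p′)`;
  `modDelta = 1` on `P_Δ ∩ K_H`, ★ `K2LiuSiegelModulusCompact.modDelta_locToAdelic_eq_one_of_mem_localInt`);
* §2 `exists_height_lambdaLoc_reading` — UNDER the local Iwasawa decomposition `H_v = P_Δ(L⁺_v)·K_{H,v}`: `∃ Hf`, (f1) `0 < Hf`, (f2) `Hf (p u) = modDelta (ι_v p)·Hf u`,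
  (f2′) squared, (f3) right `K_{H,v}`-invariance, (f4) `Hf u² ∈ q_v^ℤ`, (f5) `Hf|_{K_H} = 1`, and `Λ_{s,v}(u) = Hf(u)^{2(s−s₀)} Λ_{s₀,v}(u)`;
* §3 `exists_height_lambdaLoc_reading'` — the same WITHOUT the Iwasawa hypothesis (★ `LambdaLoc` vanishes off `P_Δ·K_H`, ★ `lambdaLoc_eq_zero`): the total height
  (`|det_Δ p_u|^{1∕2}` on `P_Δ·K_H`, `1` off it) with the left law in the COMPACT form (f2ᴷ) `Hf (p u) = Hf u` for `p ∈ P_Δ(L⁺_v) ∩ K₀`, `K₀` ANY compact subgroup, ALL `u`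
  (★ `K2LiuSiegelModulusCompact.modDelta_locToAdelic_eq_one_of_mem_compact`), the plain∕squared laws on `P_Δ·K_H`, (f3)(f4)(f5) and the reading for ALL `u`.

References: [Li1992] J.-S. Li, J. reine angew. Math. 428 (1992) §3; [Tan1999] §1 p. 166; [KudlaSweet1997] §1; [HarrisKudlaSweet1996] §1 (1.15); [GelbartRogawski1991] §3.1 (3.1.3);
[MoeglinWaldspurger1995] I.2.2, II.1.5.
HONEST LABEL.  Count-neutral helper: `HC_CM` is proved only modulo the 7 printed citations (2 remaining named inputs: hLiu418 = `stmt-HodgeConjecture-24832`,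
h413 = `stmt-HodgeConjecture-24833`) until rung 0 closes.
-/

set_option autoImplicit false
set_option linter.dupNamespace false -- the mandated namespace repeats `HodgeConjecture.HodgeConjecture`

noncomputable section

open scoped Matrix RestrictedProduct
open Filter Topology Set NumberField IsDedekindDomain
open Literature.NumberTheory.Automorphic Literature.NumberTheory.Automorphic.UnitaryGroup Literature.NumberTheory.GaloisRepresentations
open Literature.NumberTheory.GaloisRepresentations.IsNonarchimedeanLocalField
open Literature.NumberTheory.GelbartRogawski1991 Literature.NumberTheory.GelbartRogawski1991.GRConstruction
open Literature.NumberTheory.GelbartRogawski1991.UnitaryDualPair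
open Literature.NumberTheory.K2Lit.SiegelDoubled Literature.NumberTheory.K2Lit.LocalSiegelDoubled Literature.NumberTheory.K2Lit.PlaceSplitting
open Summit.HodgeConjecture.HodgeConjecture.Cruxes.HLiu418.K2LiuStdFamilyFactorisable
open Summit.HodgeConjecture.HodgeConjecture.Cruxes.HLiu418.K2LiuIwasawaDeltaUnimodular
open Summit.HodgeConjecture.HodgeConjecture.Cruxes.HLiu418.K2LiuStdFamilyAwayPurityFlat
open Summit.HodgeConjecture.HodgeConjecture.Cruxes.HLiu418.K2LiuIwasawaHeightLocalModulus
open Summit.HodgeConjecture.HodgeConjecture.Cruxes.HLiu418.K2LiuSiegelModulusCompact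

namespace Summit.HodgeConjecture.HodgeConjecture.Cruxes.HLiu418.K2LiuLambdaLocHeightReading

variable (L : Type) [Field L] [NumberField L] [IsCMField L]
variable {N M n : ℕ} (e : Fin N × Fin M ≃ Fin n)
  (dV : Fin N → L) (hdV : ∀ i, IsCMField.complexConj L (dV i) = dV i) (hdV0 : ∀ i, dV i ≠ 0)
  (dW : Fin M → L) (hdW : ∀ i, IsCMField.complexConj L (dW i) = dW i) (hdW0 : ∀ i, dW i ≠ 0)
  (v : HeightOneSpectrum (𝓞 (Fp L)))

/-! ## §0 The left law of `H_{𝒦,v}` squared -/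

include hdV0 hdW0 in
/-- the left law of `H_{𝒦,v}` in ★ D1's squared currency: `H_{𝒦,v}(p u)² = |det_Δ p|_v · H_{𝒦,v}(u)²` (★ `heightLoc_siegel_mul` + §1) — the (f2) shape of the (R2′) consumer.
[cite: HarrisKudlaSweet1996, §1 (1.15)] [cite: Tan1999, §1 p. 166] -/
theorem heightLoc_siegel_mul_sq (𝒦 : IwasawaDatum L e dV hdV dW hdW) {p : UnitaryGroup.localPi L (IsCMField.complexConj L) (n + n) (hermD L e dV hdV dW hdW) v}
    (hp : p ∈ siegelDeltaLoc L e dV hdV dW hdW v) (u : UnitaryGroup.localPi L (IsCMField.complexConj L) (n + n) (hermD L e dV hdV dW hdW) v) :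
    modDelta L e dV hdV dW hdW (𝒦.pPart (locToAdelic L e dV hdV dW hdW v (p * u))) ^ 2 =
      absDetDelta (Fp L) L (IsCMField.complexConj L) v n p * modDelta L e dV hdV dW hdW (𝒦.pPart (locToAdelic L e dV hdV dW hdW v u)) ^ 2 := by
  rw [heightLoc_siegel_mul L e dV hdV hdV0 dW hdW hdW0 v 𝒦 hp u, mul_pow, modDelta_locToAdelic_sq_eq_absDetDelta L e dV hdV dW hdW v hp]

/-! ## §1 The modulus of the `P`-part of a `P_Δ·K_H` decomposition is well defined -/

include hdV0 hdW0 in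
/-- **the modulus of the `P`-part of a `P_Δ·K_H` decomposition is well defined**: `p k = p′ k′` (`p, p′ ∈ P_Δ(L⁺_v)`, `k, k′ ∈ K_{H,v}`) ⇒ `modDelta (ι_v p) = modDelta (ι_v p′)`
(`p′⁻¹ p = k′ k⁻¹ ∈ P_Δ ∩ K_H`, ★ `K2LiuSiegelModulusCompact.modDelta_locToAdelic_eq_one_of_mem_localInt`). [cite: GelbartRogawski1991, §3.1 (3.1.3)] [cite: Li1992, §3] -/
theorem modDelta_locToAdelic_eq_of_decomp {p k p' k' : UnitaryGroup.localPi L (IsCMField.complexConj L) (n + n) (hermD L e dV hdV dW hdW) v}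
    (hp : p ∈ siegelDeltaLoc L e dV hdV dW hdW v) (hk : k ∈ UnitaryGroup.localInt L (IsCMField.complexConj L) (n + n) (hermD L e dV hdV dW hdW) v)
    (hp' : p' ∈ siegelDeltaLoc L e dV hdV dW hdW v) (hk' : k' ∈ UnitaryGroup.localInt L (IsCMField.complexConj L) (n + n) (hermD L e dV hdV dW hdW) v)
    (heq : p * k = p' * k') :
    modDelta L e dV hdV dW hdW (locToAdelic L e dV hdV dW hdW v p) = modDelta L e dV hdV dW hdW (locToAdelic L e dV hdV dW hdW v p') := by
  have h1 : p = p' * (k' * k⁻¹) := by rw [← mul_assoc, ← heq, mul_inv_cancel_right]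
  have hq : p'⁻¹ * p = k' * k⁻¹ := inv_mul_eq_of_eq_mul h1
  have hqP : p'⁻¹ * p ∈ siegelDeltaLoc L e dV hdV dW hdW v := mul_mem (inv_mem hp') hp
  have hqK : p'⁻¹ * p ∈ UnitaryGroup.localInt L (IsCMField.complexConj L) (n + n) (hermD L e dV hdV dW hdW) v := by
    rw [hq]; exact mul_mem hk' (inv_mem hk)
  have hone := modDelta_locToAdelic_eq_one_of_mem_localInt L e dV hdV hdV0 dW hdW hdW0 v hqP hqK
  calc modDelta L e dV hdV dW hdW (locToAdelic L e dV hdV dW hdW v p)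
      = modDelta L e dV hdV dW hdW (locToAdelic L e dV hdV dW hdW v (p' * (p'⁻¹ * p))) := by rw [mul_inv_cancel_left]
    _ = modDelta L e dV hdV dW hdW (locToAdelic L e dV hdV dW hdW v p') * modDelta L e dV hdV dW hdW (locToAdelic L e dV hdV dW hdW v (p'⁻¹ * p)) := by
        rw [map_mul, modDelta_mul L e dV hdV dW hdW ((mem_siegelDeltaLoc_iff L e dV hdV dW hdW v _).1 hp') ((mem_siegelDeltaLoc_iff L e dV hdV dW hdW v _).1 hqP)]
    _ = modDelta L e dV hdV dW hdW (locToAdelic L e dV hdV dW hdW v p') := by rw [hone, mul_one]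

/-! ## §2 Under the local Iwasawa decomposition `H_v = P_Δ(L⁺_v)·K_{H,v}` -/

include hdV0 hdW0 in
/-- **THE UNRAMIFIED SECTION IS A HEIGHT TWIST OF ITS VALUE AT `s₀`**: under the local Iwasawa decomposition `H_v = P_Δ(L⁺_v)·K_{H,v}` and for `χ` unramified above `v`
there is `Hf : H_v → ℝ` — the modulus `|det_Δ p_u|^{1∕2}` of the `P`-part — with (f1) `0 < Hf`, (f2) `Hf (p u) = modDelta (ι_v p) · Hf u` on `P_Δ(L⁺_v)` and, squared, `Hf (p u)² = |det_Δ p|_v · Hf u²`,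
(f3) `Hf (u k) = Hf u` for `k ∈ K_{H,v}` (open compact), (f4) `Hf u² ∈ q_v^ℤ`, (f5) `Hf = 1` on `K_{H,v}`, and THE READING `Λ_{s,v}(u) = Hf(u)^{2(s−s₀)} · Λ_{s₀,v}(u)` for ALL `s, u`
(★ `lambdaLoc_mul_eq`, ★ `modDelta_cpow_mul_siegelDeltaCharacter`).  So off `S₀` the local factor is monomial-flat on `K₀ := K_{H,v}` exactly like the `S₀`-factors (§3).
[cite: Li1992, §3] [cite: Tan1999, §1 p. 166] [cite: KudlaSweet1997, §1] [cite: HarrisKudlaSweet1996, §1 (1.15)] -/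
theorem exists_height_lambdaLoc_reading (χ : HeckeCharacter L) (hχ : ∀ w : UnitaryGroup.PlacesOver L v, χ.IsUnramifiedAt w.1)
    (hIw : ∀ h : UnitaryGroup.localPi L (IsCMField.complexConj L) (n + n) (hermD L e dV hdV dW hdW) v,
      ∃ p ∈ siegelDeltaLoc L e dV hdV dW hdW v, ∃ k ∈ UnitaryGroup.localInt L (IsCMField.complexConj L) (n + n) (hermD L e dV hdV dW hdW) v, h = p * k)
    (s₀ : ℂ) :
    ∃ Hf : UnitaryGroup.localPi L (IsCMField.complexConj L) (n + n) (hermD L e dV hdV dW hdW) v → ℝ,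
      (∀ u, 0 < Hf u) ∧
      (∀ p ∈ siegelDeltaLoc L e dV hdV dW hdW v, ∀ u, Hf (p * u) = modDelta L e dV hdV dW hdW (locToAdelic L e dV hdV dW hdW v p) * Hf u) ∧
      (∀ p ∈ siegelDeltaLoc L e dV hdV dW hdW v, ∀ u, Hf (p * u) ^ 2 = absDetDelta (Fp L) L (IsCMField.complexConj L) v n p * Hf u ^ 2) ∧
      (∀ u, ∀ k ∈ UnitaryGroup.localInt L (IsCMField.complexConj L) (n + n) (hermD L e dV hdV dW hdW) v, Hf (u * k) = Hf u) ∧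
      (∀ u, ∃ k : ℤ, Hf u ^ 2 = (residueFieldCard (v.adicCompletion (Fp L)) : ℝ) ^ k) ∧
      (∀ k ∈ UnitaryGroup.localInt L (IsCMField.complexConj L) (n + n) (hermD L e dV hdV dW hdW) v, Hf k = 1) ∧
      ∀ (s : ℂ) (u : UnitaryGroup.localPi L (IsCMField.complexConj L) (n + n) (hermD L e dV hdV dW hdW) v),
        LambdaLoc L e dV hdV dW hdW v χ s u = ((Hf u : ℝ) : ℂ) ^ (2 * (s - s₀)) * LambdaLoc L e dV hdV dW hdW v χ s₀ u := by
  choose pf hpf kf hkf hdec using hIw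
  -- the height: modulus of the chosen `P`-part (any other decomposition gives the same value)
  have hwd : ∀ {u p k}, p ∈ siegelDeltaLoc L e dV hdV dW hdW v → k ∈ UnitaryGroup.localInt L (IsCMField.complexConj L) (n + n) (hermD L e dV hdV dW hdW) v → u = p * k →
      modDelta L e dV hdV dW hdW (locToAdelic L e dV hdV dW hdW v (pf u)) = modDelta L e dV hdV dW hdW (locToAdelic L e dV hdV dW hdW v p) :=
    fun {u p k} hp hk hu => modDelta_locToAdelic_eq_of_decomp L e dV hdV hdV0 dW hdW hdW0 v (hpf u) (hkf u) hp hk ((hdec u).symm.trans hu)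
  refine ⟨fun u => modDelta L e dV hdV dW hdW (locToAdelic L e dV hdV dW hdW v (pf u)), fun u => modDelta_pos L e dV hdV dW hdW _, ?_, ?_, ?_, ?_, ?_, ?_⟩
  · -- (f2): `p u = (p · p_u) · k_u`
    intro p hp u
    beta_reduce
    rw [hwd (mul_mem hp (hpf u)) (hkf u) (by rw [mul_assoc, ← hdec u]), map_mul,
      modDelta_mul L e dV hdV dW hdW ((mem_siegelDeltaLoc_iff L e dV hdV dW hdW v _).1 hp) ((mem_siegelDeltaLoc_iff L e dV hdV dW hdW v _).1 (hpf u))]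
  · -- (f2) squared, in ★ D1's currency
    intro p hp u
    beta_reduce
    rw [hwd (mul_mem hp (hpf u)) (hkf u) (by rw [mul_assoc, ← hdec u]), map_mul,
      modDelta_mul L e dV hdV dW hdW ((mem_siegelDeltaLoc_iff L e dV hdV dW hdW v _).1 hp) ((mem_siegelDeltaLoc_iff L e dV hdV dW hdW v _).1 (hpf u)), mul_pow,
      modDelta_locToAdelic_sq_eq_absDetDelta L e dV hdV dW hdW v hp]
  · -- (f3): `u k = p_u · (k_u k)`
    intro u k hk
    beta_reduce
    exact hwd (hpf u) (mul_mem (hkf u) hk) (by rw [← mul_assoc, ← hdec u])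
  · -- (f4): §1
    exact fun u => exists_modDelta_locToAdelic_sq_eq_zpow L e dV hdV dW hdW v (hpf u)
  · -- (f5): `k = 1 · k`
    intro k hk
    beta_reduce
    rw [hwd (one_mem _) hk (one_mul k).symm, map_one, modDelta_one']
  · -- the reading: `Λ_s(p k) = δ_{χ,s}(ι_v p) = modDelta(ι_v p)^{2(s−s₀)} δ_{χ,s₀}(ι_v p)`
    intro s u
    beta_reduce
    have hΛ : ∀ s' : ℂ, LambdaLoc L e dV hdV dW hdW v χ s' u = siegelCharLoc L e dV hdV dW hdW v χ s' (pf u) := fun s' => by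
      conv_lhs => rw [hdec u]
      exact lambdaLoc_mul_eq L e dV hdV dW hdW v χ s' hχ (hpf u) (hkf u)
    rw [hΛ s, hΛ s₀, siegelCharLoc_apply, siegelCharLoc_apply, modDelta_cpow_mul_siegelDeltaCharacter e dV hdV dW hdW χ s₀ s]

/-! ## §3 Without the Iwasawa hypothesis: the total height -/

/-- no `P_Δ·K_H` decomposition for `p u` (resp. `u k`) if none for `u` (`p ∈ P_Δ(L⁺_v)`, `k ∈ K_{H,v}`). [cite: Li1992, §3] -/
theorem not_exists_isSiegelIntDecomp_mul {u : UnitaryGroup.localPi L (IsCMField.complexConj L) (n + n) (hermD L e dV hdV dW hdW) v}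
    (hu : ¬ ∃ pk, IsSiegelIntDecomp L e dV hdV dW hdW v u pk)
    {p k : UnitaryGroup.localPi L (IsCMField.complexConj L) (n + n) (hermD L e dV hdV dW hdW) v} (hp : p ∈ siegelDeltaLoc L e dV hdV dW hdW v)
    (hk : k ∈ UnitaryGroup.localInt L (IsCMField.complexConj L) (n + n) (hermD L e dV hdV dW hdW) v) :
    ¬ ∃ pk, IsSiegelIntDecomp L e dV hdV dW hdW v (p * u * k) pk := by
  rintro ⟨⟨p', k'⟩, hp', hk', heq⟩
  refine hu ⟨(p⁻¹ * p', k' * k⁻¹), mul_mem (inv_mem hp) hp', mul_mem hk' (inv_mem hk), ?_⟩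
  show u = p⁻¹ * p' * (k' * k⁻¹)
  have h1 : u = p⁻¹ * (p * u * k) * k⁻¹ := by group
  rw [h1, heq]
  group

include hdV0 hdW0 in
/-- **THE UNRAMIFIED SECTION IS A HEIGHT TWIST OF ITS VALUE AT `s₀` — NO IWASAWA HYPOTHESIS.**  For `χ` unramified above `v` there is `Hf : H_v → ℝ` (`|det_Δ p_u|^{1∕2}` on `P_Δ·K_H`, `1` off it) with
(f1) `0 < Hf`; (f2ᴷ) `Hf (p u) = Hf u` for `p ∈ P_Δ(L⁺_v) ∩ K₀`, `K₀` ANY compact subgroup, and ALL `u`; (f2) `Hf (p u) = modDelta (ι_v p) · Hf u` and (f2′) `Hf (p u)² = |det_Δ p|_v · Hf u²` for `u ∈ P_Δ·K_H`;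
(f3) `Hf (u k) = Hf u` (`k ∈ K_{H,v}`, all `u`); (f4) `Hf u² ∈ q_v^ℤ`; (f5) `Hf = 1` on `K_{H,v}`; and THE READING `Λ_{s,v}(u) = Hf(u)^{2(s−s₀)} Λ_{s₀,v}(u)` for ALL `s, u` (off `P_Δ·K_H` both sides vanish,
★ `lambdaLoc_eq_zero`). [cite: Li1992, §3] [cite: Tan1999, §1 p. 166] [cite: KudlaSweet1997, §1] [cite: HarrisKudlaSweet1996, §1 (1.15)] -/
theorem exists_height_lambdaLoc_reading' (χ : HeckeCharacter L) (hχ : ∀ w : UnitaryGroup.PlacesOver L v, χ.IsUnramifiedAt w.1) (s₀ : ℂ) :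
    ∃ Hf : UnitaryGroup.localPi L (IsCMField.complexConj L) (n + n) (hermD L e dV hdV dW hdW) v → ℝ,
      (∀ u, 0 < Hf u) ∧
      (∀ K₀ : Subgroup (UnitaryGroup.localPi L (IsCMField.complexConj L) (n + n) (hermD L e dV hdV dW hdW) v),
        IsCompact (K₀ : Set (UnitaryGroup.localPi L (IsCMField.complexConj L) (n + n) (hermD L e dV hdV dW hdW) v)) →
          ∀ p ∈ siegelDeltaLoc L e dV hdV dW hdW v, p ∈ K₀ → ∀ u, Hf (p * u) = Hf u) ∧
      (∀ p ∈ siegelDeltaLoc L e dV hdV dW hdW v, ∀ u, (∃ pk, IsSiegelIntDecomp L e dV hdV dW hdW v u pk) →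
        Hf (p * u) = modDelta L e dV hdV dW hdW (locToAdelic L e dV hdV dW hdW v p) * Hf u) ∧
      (∀ p ∈ siegelDeltaLoc L e dV hdV dW hdW v, ∀ u, (∃ pk, IsSiegelIntDecomp L e dV hdV dW hdW v u pk) →
        Hf (p * u) ^ 2 = absDetDelta (Fp L) L (IsCMField.complexConj L) v n p * Hf u ^ 2) ∧
      (∀ u, ∀ k ∈ UnitaryGroup.localInt L (IsCMField.complexConj L) (n + n) (hermD L e dV hdV dW hdW) v, Hf (u * k) = Hf u) ∧
      (∀ u, ∃ k : ℤ, Hf u ^ 2 = (residueFieldCard (v.adicCompletion (Fp L)) : ℝ) ^ k) ∧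
      (∀ k ∈ UnitaryGroup.localInt L (IsCMField.complexConj L) (n + n) (hermD L e dV hdV dW hdW) v, Hf k = 1) ∧
      ∀ (s : ℂ) (u : UnitaryGroup.localPi L (IsCMField.complexConj L) (n + n) (hermD L e dV hdV dW hdW) v),
        LambdaLoc L e dV hdV dW hdW v χ s u = ((Hf u : ℝ) : ℂ) ^ (2 * (s - s₀)) * LambdaLoc L e dV hdV dW hdW v χ s₀ u := by
  classical
  -- the total height (kept opaque behind its defining equation)
  obtain ⟨Hf, hHf⟩ : ∃ Hf : UnitaryGroup.localPi L (IsCMField.complexConj L) (n + n) (hermD L e dV hdV dW hdW) v → ℝ, ∀ u, Hf u =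
      if hh : ∃ pk, IsSiegelIntDecomp L e dV hdV dW hdW v u pk then modDelta L e dV hdV dW hdW (locToAdelic L e dV hdV dW hdW v (Classical.choose hh).1) else 1 :=
    ⟨_, fun u => rfl⟩
  -- its value on `P_Δ·K_H` is the modulus of ANY `P`-part, and `1` off `P_Δ·K_H`
  have hval : ∀ {u p k : UnitaryGroup.localPi L (IsCMField.complexConj L) (n + n) (hermD L e dV hdV dW hdW) v}, p ∈ siegelDeltaLoc L e dV hdV dW hdW v →
      k ∈ UnitaryGroup.localInt L (IsCMField.complexConj L) (n + n) (hermD L e dV hdV dW hdW) v → u = p * k →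
      Hf u = modDelta L e dV hdV dW hdW (locToAdelic L e dV hdV dW hdW v p) := by
    intro u p k hp hk hu
    have hh : ∃ pk, IsSiegelIntDecomp L e dV hdV dW hdW v u pk := ⟨(p, k), hp, hk, hu⟩
    have h1 : Hf u = modDelta L e dV hdV dW hdW (locToAdelic L e dV hdV dW hdW v (Classical.choose hh).1) := by rw [hHf u]; exact dif_pos hh
    obtain ⟨hp', hk', heq⟩ := Classical.choose_spec hh
    rw [h1]
    exact modDelta_locToAdelic_eq_of_decomp L e dV hdV hdV0 dW hdW hdW0 v hp' hk' hp hk (heq.symm.trans hu)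
  have hnone : ∀ {u : UnitaryGroup.localPi L (IsCMField.complexConj L) (n + n) (hermD L e dV hdV dW hdW) v}, (¬ ∃ pk, IsSiegelIntDecomp L e dV hdV dW hdW v u pk) → Hf u = 1 := by
    intro u hu
    rw [hHf u]
    exact dif_neg hu
  -- the plain left law on `P_Δ·K_H`, proved once
  have hf2 : ∀ {p u p' k : UnitaryGroup.localPi L (IsCMField.complexConj L) (n + n) (hermD L e dV hdV dW hdW) v}, p ∈ siegelDeltaLoc L e dV hdV dW hdW v →
      p' ∈ siegelDeltaLoc L e dV hdV dW hdW v → k ∈ UnitaryGroup.localInt L (IsCMField.complexConj L) (n + n) (hermD L e dV hdV dW hdW) v → u = p' * k →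
      Hf (p * u) = modDelta L e dV hdV dW hdW (locToAdelic L e dV hdV dW hdW v p) * Hf u := by
    intro p u p' k hp hp' hk hu
    rw [hval hp' hk hu, hval (mul_mem hp hp') hk (by rw [hu, mul_assoc]), map_mul,
      modDelta_mul L e dV hdV dW hdW ((mem_siegelDeltaLoc_iff L e dV hdV dW hdW v _).1 hp) ((mem_siegelDeltaLoc_iff L e dV hdV dW hdW v _).1 hp')]
  refine ⟨Hf, fun u => ?_, fun K₀ hK₀ p hp hpK u => ?_, fun p hp u hu => ?_, fun p hp u hu => ?_, fun u k hk => ?_, fun u => ?_, fun k hk => ?_, fun s u => ?_⟩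
  · -- (f1)
    by_cases hh : ∃ pk, IsSiegelIntDecomp L e dV hdV dW hdW v u pk
    · obtain ⟨⟨p, k⟩, hp, hk, hu⟩ := hh
      rw [hval hp hk hu]
      exact modDelta_pos L e dV hdV dW hdW _
    · rw [hnone hh]
      exact one_pos
  · -- (f2ᴷ)
    by_cases hh : ∃ pk, IsSiegelIntDecomp L e dV hdV dW hdW v u pk
    · obtain ⟨⟨p', k⟩, hp', hk, hu⟩ := hh
      rw [hf2 hp hp' hk hu, modDelta_locToAdelic_eq_one_of_mem_compact L e dV hdV hdV0 dW hdW hdW0 v K₀ hK₀ hp hpK, one_mul]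
    · have h1 := not_exists_isSiegelIntDecomp_mul L e dV hdV dW hdW v hh hp (one_mem (UnitaryGroup.localInt L (IsCMField.complexConj L) (n + n) (hermD L e dV hdV dW hdW) v))
      rw [mul_one] at h1
      rw [hnone hh, hnone h1]
  · -- (f2) on `P_Δ·K_H`
    obtain ⟨⟨p', k⟩, hp', hk, hu'⟩ := hu
    exact hf2 hp hp' hk hu'
  · -- (f2′) on `P_Δ·K_H`
    obtain ⟨⟨p', k⟩, hp', hk, hu'⟩ := hu
    rw [hf2 hp hp' hk hu', mul_pow, modDelta_locToAdelic_sq_eq_absDetDelta L e dV hdV dW hdW v hp]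
  · -- (f3)
    by_cases hh : ∃ pk, IsSiegelIntDecomp L e dV hdV dW hdW v u pk
    · obtain ⟨⟨p, k'⟩, hp, hk', hu⟩ := hh
      rw [hval hp hk' hu, hval hp (mul_mem hk' hk) (by rw [hu, mul_assoc])]
    · have h1 := not_exists_isSiegelIntDecomp_mul L e dV hdV dW hdW v hh (one_mem (siegelDeltaLoc L e dV hdV dW hdW v)) hk
      rw [one_mul] at h1
      rw [hnone hh, hnone h1]
  · -- (f4)
    by_cases hh : ∃ pk, IsSiegelIntDecomp L e dV hdV dW hdW v u pk
    · obtain ⟨⟨p, k⟩, hp, hk, hu⟩ := hh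
      rw [hval hp hk hu]
      exact exists_modDelta_locToAdelic_sq_eq_zpow L e dV hdV dW hdW v hp
    · exact ⟨0, by rw [hnone hh, one_pow, zpow_zero]⟩
  · -- (f5)
    rw [hval (one_mem _) hk (one_mul k).symm, map_one, modDelta_one']
  · -- the reading
    by_cases hh : ∃ pk, IsSiegelIntDecomp L e dV hdV dW hdW v u pk
    · obtain ⟨⟨p, k⟩, hp, hk, hu⟩ := hh
      have hΛ : ∀ s' : ℂ, LambdaLoc L e dV hdV dW hdW v χ s' u = siegelCharLoc L e dV hdV dW hdW v χ s' p := fun s' => by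
        rw [hu]
        exact lambdaLoc_mul_eq L e dV hdV dW hdW v χ s' hχ hp hk
      rw [hval hp hk hu, hΛ s, hΛ s₀, siegelCharLoc_apply, siegelCharLoc_apply, modDelta_cpow_mul_siegelDeltaCharacter e dV hdV dW hdW χ s₀ s]
    · rw [lambdaLoc_eq_zero L e dV hdV dW hdW v χ s hh, lambdaLoc_eq_zero L e dV hdV dW hdW v χ s₀ hh, mul_zero]

end Summit.HodgeConjecture.HodgeConjecture.Cruxes.HLiu418.K2LiuLambdaLocHeightReading

end
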